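import Summits.MatrixMultiplication.MatrixMultiplication.Theorems.SaturationLadderWindow108A
import Summits.MatrixMultiplication.MatrixMultiplication.Theorems.SaturationLadderWindow108B
import Summits.MatrixMultiplication.MatrixMultiplication.Theorems.SaturationLadderWindow108C
import Summits.MatrixMultiplication.MatrixMultiplication.Theorems.SaturationLadderUniformWindow
import Summits.MatrixMultiplication.MatrixMultiplication.Theorems.SaturationLadderBandClauses
import Summits.MatrixMultiplication.MatrixMultiplication.Theorems.SaturationLadderExplicitCeilingClause
import Literature.Computability.AlgebraicComplexity.BigCwFourthTools
import HarnessLib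

/-!
# SaturationLadder — Kernel XXX (v): the uniform rung `U(27/25)` — `Δ(r) ≤ 1.08` for ALL `r ≥ 1`

Support for the deciding crux `SubexpSaturation` (h₁, item 25909) of `Theses/SaturationLadder.lean`
(cell `decomp-mm`, lens «grading / quantitative ladder», gen 57).  No new hypotheses, no `sorry`.

THE CRUX asks: for every `c > 0` there is an onset `t₀(c) < 1` such that every `t ∈ [t₀, 1)` is tight
(`ω(1,t,r) = 1 + r`) at some `r ∈ [1, e^{c/(1−t)}]`; equivalently the frontier defect
`Δ(r) := (1 − τ_ℂ(r))·log r → 0` (`Theorems/SaturationLadderUniformDefect.lean`).  The quantitative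
ladder of this cell proves the clause for explicit rates; its state after this file:

| regime | rates | onset | file |
|---|---|---|---|
| uniform (`Δ(r) ≤ C ∀ r ≥ 1`) | `2 log 2`, `6/5`, `1.09` | `0` | `…UniformDefect`, `…UniformSixFifths`, `…Uniform109` |
| **uniform** | **`C ≥ 27/25 = 1.08`** | **`0`** | **this file** |
| eventual, formula onset | every `C > c₂ = 1.06505…` | `max(11/12, 1 − 81(C−c₂)/(80+162(C−c₂)))` | `…ExplicitCeilingClause` (gen 57) |
| nothing | `C ≤ c₂` | — | (stage-2 class ceiling; the crux needs `C → 0`) |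

MAIN RESULTS.
* `uniformClause_108` — **`U(1.08)`: every `t ∈ [0,1)` is tight at some `r ∈ [1, e^{1.08/(1−t)}]`**
  (`uniformClause_27_25` is the same with the exact rational `27/25`).
* `frontierDefect_le_108` — **`Δ(r) ≤ 1.08` for every `r ≥ 1`.**
* `subexpClause_of_ge` — the crux's clause, verbatim, for every rate `c ≥ 27/25` (onset `0`).
* `ladder_state` — the two regimes in one statement: eventual for every `C > c₂` (Kernel XXIX), uniform
  for every `C ≥ 27/25`.
* Placement numerics: `lt_familyCeiling` (`1.08 < 47 log 2/30 = 1.0859…`, the ceiling of EVERY argument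
  through the monotone integer-family clause — the uniform constant is now below it, which gen 55 recorded
  as impossible for that method), `classCeiling_gt` / `gap_lt` (`1.065 < c₂`, `1.08 − c₂ < 0.015`).

ASSEMBLY (`uniformClause_of_window`): (a) the flat-rate pencil-member clause `BandClauses.clause_5_6`
(`κ = 5/6`, rate `(14/9) log 2 ≤ 1.0783 ≤ 1.08`) from its onset `t₉₂(5/6) = 25576/26009 ≈ 0.98335`;
(b) the certified window `[0, 25576/26009]` of `Theorems/SaturationLadderWindow108A|B|C.lean` — 56 chord
pieces through 57 exact points: 32 tree points (origin, `X(1/3)`, 30 twin points of `…TwinTable|B|C`,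
`…TwinExactInstances`) and the 25 points of `…Window108Points` (23 band members `memⱼ(κ)`, among them the
onset point `mem₉₂(5/6)` itself, and 2 six-type twins `six₄`, `six₆`).

HONEST LABEL.  `U(1.08)` is NECESSARY-side support, WEAKER than the crux (a fixed rate, not `c → 0`), in
the same technique class as `U(1.09)` (stage-2 Coppersmith–Winograd twins and pencil members, convexity,
certified numerics).  By the cell critic's ruling (bus `decomp-mm/STATUS.md`, gen 57 ASK (a)) this is the
LAST uniform file of this class: the in-class floor for chord windows is the class ceiling `c₂ = 1.06505`
(defect of the best band members `→ c₂`; at rate `C` the last `O(1/(C − c₂))` scales must be visited one by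
one), so `U(1.07)` would cost `≈ 250` pieces and `U(c₂ + ε)` is unreachable; below `c₂` nothing of stage 2
survives (`…TwinSaturation`, `…StageCeiling*`).  The eventual regime is already closed down to `c₂` in
closed form (Kernel XXIX), so the remaining distance to the crux is exactly the class ceiling.

References: D. Coppersmith, S. Winograd, J. Symbolic Comput. 9 (1990) §§6, 8 (key
`CoppersmithWinograd1990`); J. Alman, R. Duan, V. Vassilevska Williams, Y. Xu, Z. Xu, R. Zhou, SODA
2025, Thm 3.2, §3.4 (key `AlmanDuanVassilevskaWilliamsXuXuZhou2025`); G. Lotti, F. Romani, Theoret.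
Comput. Sci. 23 (1983) 171–185, §1 (key `LottiRomani1983`); X. Huang, V. Y. Pan, J. Complexity 14 (1998)
§2 (key `HuangPan1998`); F. Le Gall, F. Urrutia, SODA 2018, §1 (key `LeGallUrrutia2018`).
-/

set_option linter.dupNamespace false
-- (single-conjunct summit: the namespace repeats `MatrixMultiplication`)

noncomputable section

namespace Summit.MatrixMultiplication.MatrixMultiplication.Theorems.SaturationLadderUniform108

open Literature.Computability.AlgebraicComplexity
open Summit.MatrixMultiplication.MatrixMultiplication.Theorems.SaturationLadderUniformDefect
  (uniformClause_iff_defect uniformClause_mono)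
open Summit.MatrixMultiplication.MatrixMultiplication.Theorems.SaturationLadderUniformWindow
  (uniformClause_of_window defect_le_beyond_onset)
open Summit.MatrixMultiplication.MatrixMultiplication.Theorems.SaturationLadderSixFifthsWindow
  (cover_append)
open Summit.MatrixMultiplication.MatrixMultiplication.Theorems.SaturationLadderBandClauses
  (clause_5_6)
open Summit.MatrixMultiplication.MatrixMultiplication.Theorems.SaturationLadderExplicitCeilingClause
  (clause_explicit_onset)
open Summit.MatrixMultiplication.MatrixMultiplication.Theorems.SaturationLadderWindow108A (coverA)
open Summit.MatrixMultiplication.MatrixMultiplication.Theorems.SaturationLadderWindow108B (coverB)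
open Summit.MatrixMultiplication.MatrixMultiplication.Theorems.SaturationLadderWindow108C (coverC)

/-! ## §1 The window `[0, t₉₂(5/6)]` and the uniform rung -/

/-- **The certified window**: every `t ∈ [0, 25576/26009]` is tight at some `r ∈ [1, e^{1.08/(1−t)}]`
(the three partial covers of `Theorems/SaturationLadderWindow108A|B|C.lean` glued).
[cite: LottiRomani1983, §1 (p. 173)] -/
theorem cover : ∀ t : ℝ, 0 ≤ t → t ≤ 25576 / 26009 →
    ∃ r : ℝ, 1 ≤ r ∧ r ≤ Real.exp ((27 / 25) / (1 - t)) ∧ omegaRect ℂ 1 t r ≤ 1 + r :=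
  cover_append coverA (cover_append coverB coverC)

/-- The window in the shape `uniformClause_of_window` wants (`t < 25576/26009`). [folklore] -/
theorem window_108 : ∀ t : ℝ, 0 ≤ t → t < (25576 : ℝ) / 26009 →
    ∃ r : ℝ, 1 ≤ r ∧ r ≤ Real.exp ((27 / 25) / (1 - t)) ∧ omegaRect ℂ 1 t r ≤ 1 + r :=
  fun t ht0 ht1 => cover t ht0 ht1.le

/-- The tail beyond the window read as a defect bound: the flat-rate clause `clause_5_6` alone gives
`Δ(r) ≤ 1.0783` for `r ≥ e^{65}` (`e^{1.0783/(1−t₉₂)} ≤ e^{65}`; kept as the record of what the tail gives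
by itself). [cite: CoppersmithWinograd1990, §8] [cite: AlmanDuanVassilevskaWilliamsXuXuZhou2025, Thm. 3.2, §3.4] -/
theorem frontierDefect_le_tail_beyond {r : ℝ} (hr : Real.exp 65 ≤ r) :
    (1 - sSup {t : ℝ | omegaRect ℂ 1 t r ≤ 1 + r}) * Real.log r ≤ 1.0783 := by
  refine defect_le_beyond_onset (c := 1.0783) (t₀ := (25576 : ℝ) / 26009) (by norm_num) (by norm_num)
    clause_5_6 r (le_trans ?_ hr)
  exact Real.exp_le_exp.2 (by norm_num)

/-- **MAIN THEOREM (exact rational form) — the uniform rung `U(27/25)`: every `t ∈ [0, 1)` is tight at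
some `r ∈ [1, e^{(27/25)/(1−t)}]`.** [cite: CoppersmithWinograd1990, §8] [cite: LottiRomani1983, §1 (p. 173)] -/
theorem uniformClause_27_25 :
    ∀ t : ℝ, 0 ≤ t → t < 1 → ∃ r : ℝ, 1 ≤ r ∧
      r ≤ Real.exp ((27 / 25) / (1 - t)) ∧ omegaRect ℂ 1 t r ≤ 1 + r :=
  uniformClause_of_window (c := 1.0783) (C := 27 / 25) (t₀ := (25576 : ℝ) / 26009) (by norm_num)
    clause_5_6 window_108

/-- **MAIN THEOREM — `U(1.08)`: every `t ∈ [0, 1)` is tight at some `r ∈ [1, e^{1.08/(1−t)}]`.**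
[cite: CoppersmithWinograd1990, §8] [cite: LottiRomani1983, §1 (p. 173)] -/
theorem uniformClause_108 :
    ∀ t : ℝ, 0 ≤ t → t < 1 → ∃ r : ℝ, 1 ≤ r ∧
      r ≤ Real.exp (1.08 / (1 - t)) ∧ omegaRect ℂ 1 t r ≤ 1 + r :=
  uniformClause_mono (by norm_num) uniformClause_27_25

/-- **`Δ(r) = (1 − τ_ℂ(r))·log r ≤ 1.08` for EVERY `r ≥ 1`.** [cite: CoppersmithWinograd1990, §8]
[cite: HuangPan1998, §2] -/
theorem frontierDefect_le_108 {r : ℝ} (hr : 1 ≤ r) :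
    (1 - sSup {t : ℝ | omegaRect ℂ 1 t r ≤ 1 + r}) * Real.log r ≤ 1.08 :=
  (uniformClause_iff_defect (by norm_num)).1 uniformClause_108 r hr

/-- `Δ(r) ≤ 27/25` for every `r ≥ 1` (exact rational form). [cite: CoppersmithWinograd1990, §8] -/
theorem frontierDefect_le_27_25 {r : ℝ} (hr : 1 ≤ r) :
    (1 - sSup {t : ℝ | omegaRect ℂ 1 t r ≤ 1 + r}) * Real.log r ≤ 27 / 25 :=
  (uniformClause_iff_defect (by norm_num)).1 uniformClause_27_25 r hr

/-- **The crux's clause, verbatim, for every rate `c ≥ 27/25`** (onset `t₀ = 0`):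
`∃ t₀ < 1, ∀ t ∈ [t₀,1), ∃ r ∈ [1, e^{c/(1−t)}], ω(1,t,r) ≤ 1 + r`.  (`SubexpSaturation` asks this for
every `c > 0`.) [cite: CoppersmithWinograd1990, §8] -/
theorem subexpClause_of_ge {c : ℝ} (hc : 27 / 25 ≤ c) :
    ∃ t₀ : ℝ, t₀ < 1 ∧ ∀ t : ℝ, t₀ ≤ t → t < 1 →
      ∃ r : ℝ, 1 ≤ r ∧ r ≤ Real.exp (c / (1 - t)) ∧ omegaRect ℂ 1 t r ≤ 1 + r :=
  ⟨0, by norm_num, fun t ht0 ht1 => uniformClause_mono hc uniformClause_27_25 t ht0 ht1⟩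

/-! ## §2 The state of the ladder: two regimes -/

/-- **The quantitative ladder after gen 57, in one statement.**  (i) EVENTUAL: for every rate above the
class ceiling `c₂ = (5 log(5/4) + 3 log 2)/3` the clause holds from an explicit onset (Kernel XXIX,
`…ExplicitCeilingClause.clause_explicit_onset`); (ii) UNIFORM: for every rate `C ≥ 27/25` it holds from
`t₀ = 0`. [cite: CoppersmithWinograd1990, §8] [cite: AlmanDuanVassilevskaWilliamsXuXuZhou2025, Thm. 3.2, §3.4] -/
theorem ladder_state :
    (∀ C : ℝ, (5 * Real.log (5 / 4) + 3 * Real.log 2) / 3 < C →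
      ∃ t₀ : ℝ, t₀ < 1 ∧ ∀ t : ℝ, t₀ ≤ t → t < 1 →
        ∃ r : ℝ, 1 ≤ r ∧ r ≤ Real.exp (C / (1 - t)) ∧ omegaRect ℂ 1 t r ≤ 1 + r) ∧
    (∀ C : ℝ, 27 / 25 ≤ C → ∀ t : ℝ, 0 ≤ t → t < 1 →
        ∃ r : ℝ, 1 ≤ r ∧ r ≤ Real.exp (C / (1 - t)) ∧ omegaRect ℂ 1 t r ≤ 1 + r) := by
  refine ⟨fun C hC => ?_, fun C hC => uniformClause_mono hC uniformClause_27_25⟩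
  obtain ⟨t₀, -, ht₀, h⟩ := clause_explicit_onset hC
  exact ⟨t₀, ht₀, h⟩

/-! ## §3 Placement numerics -/

/-- `27/25 < 47 log 2 / 30 = 1.0859…`: the uniform constant is now BELOW the ceiling of the monotone
integer-family clause (`…Uniform109.familyClause_ceiling_gt`; `log 2 > 0.6931471803`). [folklore] -/
theorem lt_familyCeiling : (27 : ℝ) / 25 < 47 * Real.log 2 / 30 := by
  have hl := Real.log_two_gt_d9
  linarith

/-- Hence a uniform rung below the integer-family ceiling exists. [cite: CoppersmithWinograd1990, §8] -/
theorem exists_uniformClause_lt_familyCeiling :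
    ∃ C : ℝ, C < 47 * Real.log 2 / 30 ∧ ∀ t : ℝ, 0 ≤ t → t < 1 → ∃ r : ℝ, 1 ≤ r ∧
      r ≤ Real.exp (C / (1 - t)) ∧ omegaRect ℂ 1 t r ≤ 1 + r :=
  ⟨27 / 25, lt_familyCeiling, uniformClause_27_25⟩

/-- `1.065 < c₂ = (5 log(5/4) + 3 log 2)/3` (`log 5 ≥ 2 log 2 + 0.2231435…` by the series of
`BigCwFourthTools.log_five_ge_series`, `log 2 > 0.6931471803`). [folklore] -/
theorem classCeiling_gt : (1.065 : ℝ) < (5 * Real.log (5 / 4) + 3 * Real.log 2) / 3 := by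
  have hl := Real.log_two_gt_d9
  have h5 := log_five_ge_series
  have e : Real.log (5 / 4) = Real.log 5 - 2 * Real.log 2 := by
    rw [Real.log_div (by norm_num) (by norm_num), show (4 : ℝ) = 2 ^ 2 by norm_num, Real.log_pow]
    push_cast; ring
  rw [e]
  norm_num at h5 ⊢
  linarith

/-- **The gap**: `27/25 − c₂ < 0.015` — the uniform constant sits within `0.015` of the stage-2 class
ceiling, below which no argument of this technique class goes. [folklore] -/
theorem gap_lt : (27 : ℝ) / 25 - (5 * Real.log (5 / 4) + 3 * Real.log 2) / 3 < 0.015 := by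
  have h := classCeiling_gt
  linarith

end Summit.MatrixMultiplication.MatrixMultiplication.Theorems.SaturationLadderUniform108
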